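import Literature.Computability.AlgebraicComplexity.BLMW11WeaklySkewToSkewProofs
import Literature.Computability.AlgebraicComplexity.LinSubst
import HarnessLib

/-!
# Skew (and weakly-skew) circuits under linear substitution of variables

BLMW 2011 §9.3 works with orbit closures `\overline{GL_N · g}` inside the classes `VP_ws`,
`\overline{VP_ws}` ("both classes are closed under p-projections", and the `GL_N`/`End`-action on
`S^n ℂ^N` underlying Def. 9.3.1 and §9.4): the complexity measures must be (polynomially) stable
under the linear substitution `X i ↦ ∑ j A j i • X j` of the tree's `linSubst` (`LinSubst.lean`,
Mulmuley–Sohoni 2001 §4). This file proves that stability for the corrected skew and weakly-skew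
measures of `BLMW11KroneckerApproximation.lean`:

* `ArithCircuit.LinSubstSkew.exists_skew_linSubst`: a well-formed fan-in-two SKEW circuit `P`
  and a square matrix `A` give a well-formed fan-in-two skew circuit computing
  `linSubst σ k A P.eval` with `|σ|(|σ|+1) + (2|σ|+2) · P.size` gates;
* `ArithCircuit.skewComplexity_linSubst_le :
    skewComplexity (linSubst σ k A g) ≤ |σ|(|σ|+1) + (2|σ|+2) · skewComplexity g`;
* `ArithCircuit.wsComplexity_linSubst_le :
    wsComplexity (linSubst σ k A g) ≤ |σ|(|σ|+1) + (2|σ|+2) · (4 · wsComplexity g)`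
  (through `wsComplexity_le_skewComplexity` and `skewComplexity_le_four_mul_wsComplexity`);
* orbit forms `ArithCircuit.skewComplexity_le_of_mem_endOrbit`, `wsComplexity_le_of_mem_endOrbit`,
  `wsComplexity_le_of_mem_glOrbit`, and the class-level `IsVPwsFamily.of_mem_endOrbit`
  (`VP_ws` is closed under endomorphism orbits with p-bounded numbers of variables).

Construction (a register program, `ArithCircuit.RegProg` of `HI16DetSkewCircuitProofs`): the
linear forms `ℓ_i = ∑ j A j i X j` as chains of binary sums (`lf i t`); every gate `l` of `P` gets a
register `node l` with value `linSubst A (v_l)` — a sum gate is copied operand-wise (variables read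
the registers `ℓ_i`), a product gate without variable operands is copied (it stays skew), and a
binary product gate with a variable operand, `u · X i`, is EXPANDED as
`∑ j A j i • (u' · X j)` with `u'` the register of `u` (skew products `pm l t`, partial sums `ps l t`),
since `u' · ℓ_i` itself would not be a skew gate. Ranks are explicit (`rank`), so the compiled
circuit is well formed (`RegProg.wellFormed_compile`, `RegProgWellFormed.lean`).

## References
* [BurgisserEtAl2011] Bürgisser–Landsberg–Manivel–Weyman 2011, §9.3 (closure under the linear
  action / p-projections of `VP_ws`, `\overline{VP_ws}`), §9.4.
* [MulmuleySohoni2001] Mulmuley–Sohoni 2001, §4 (the action by linear substitution).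
* [Burgisser2000] Bürgisser 2000, Def. 2.1 (the circuit model).
-/

universe u v

open MvPolynomial

namespace Literature.Computability.AlgebraicComplexity

namespace ArithCircuit

namespace LinSubstSkew

variable {k : Type u} [CommRing k] {σ : Type v} [Fintype σ]
variable (P : ArithCircuit k σ) (A : Matrix σ σ k)

/-- The enumeration of the variables used to order the sums. [folklore] -/
noncomputable def enum (σ : Type v) [Fintype σ] : Fin (Fintype.card σ) ≃ σ :=
  (Fintype.equivFin σ).symm

/-- The index of a variable in the enumeration. [folklore] -/
noncomputable def idx (j : σ) : ℕ := ((enum σ).symm j : ℕ)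

/-- `idx` is injective. [folklore] -/
private theorem idx_injective : Function.Injective (idx (σ := σ)) := fun _ _ h =>
  (enum σ).symm.injective (Fin.ext h)

/-- `idx` of the `t`-th variable. [folklore] -/
private theorem idx_enum (t : Fin (Fintype.card σ)) : idx (enum σ t) = t := by
  simp [idx]

/-- `idx` is below the number of variables. [folklore] -/
private theorem idx_lt (j : σ) : idx j < Fintype.card σ := ((enum σ).symm j).isLt

/-- The registers: partial linear forms `lf i t = ∑_{idx j < t} A j i • X j`, gate copies
`node l`, and the expansion registers `pm l t` (skew products) / `ps l t` (their partial sums) of a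
product gate with a variable operand. [cite: BurgisserEtAl2011, §9.3 (closure under the linear action)] -/
inductive LReg (σ : Type v) : Type v
  /-- Partial linear form `∑_{idx j < t} A j i • X j`. -/
  | lf (i : σ) (t : ℕ) : LReg σ
  /-- The copy of gate `l`: value `linSubst A v_l`. -/
  | node (l : ℕ) : LReg σ
  /-- Skew product `u' · X (enum t)` for the expanded product gate `l`. -/
  | pm (l t : ℕ) : LReg σ
  /-- Partial sum `∑_{idx j < t} A j i • (u' · X j)` for the expanded product gate `l`. -/
  | ps (l t : ℕ) : LReg σ
  deriving DecidableEq

/-- The partial linear form `∑_{idx j < t} A j i • X j` (the full form `linSubst A (X i)` for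
`t ≥ |σ|`). [cite: MulmuleySohoni2001, §4] -/
noncomputable def lformP (i : σ) (t : ℕ) : MvPolynomial σ k :=
  ∑ j ∈ Finset.univ.filter (fun j => idx j < t), A j i • X j

/-- An operand of `P` read in the new program: gate `j ↦ node j`, variable `i ↦` its linear form
register `lf i |σ|`, constant `↦` constant. [cite: BurgisserEtAl2011, §9.3 (closure under the linear action)] -/
noncomputable def sOp : Operand k σ → ROperand k σ (LReg σ)
  | .gate j => .reg (.node j)
  | .var i => .reg (.lf i (Fintype.card σ))
  | .const c => .const c

/-- The data of an EXPANDED product gate `l`: a binary product gate with a variable operand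
`X i`; returns the other operand `u` and `i`. [cite: BurgisserEtAl2011, §9.3 (closure under the linear action)] -/
def prodSrc (l : ℕ) : Option (Operand k σ × σ) :=
  match P.gates[l]? with
  | some (.prod [u, .var i]) => some (u, i)
  | some (.prod [.var i, u]) => some (u, i)
  | _ => none

/-- The value of the non-expanded factor of an expanded product gate (junk `0`).
[cite: BurgisserEtAl2011, §9.3 (closure under the linear action)] -/
noncomputable def bval (l : ℕ) : MvPolynomial σ k :=
  match prodSrc P l with
  | some (u, _) => linSubst σ k A (P.opVal l u)
  | none => 0

/-- The defining gates. [cite: BurgisserEtAl2011, §9.3 (closure under the linear action)] -/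
noncomputable def gateOf : LReg σ → RGate k σ (LReg σ)
  | .lf _ 0 => .sum []
  | .lf i (t + 1) =>
    if h : t < Fintype.card σ then
      .sum [(1, .reg (.lf i t)), (A (enum σ ⟨t, h⟩) i, .var (enum σ ⟨t, h⟩))]
    else .sum [(1, .reg (.lf i t))]
  | .node l =>
    match P.gates[l]?, prodSrc P l with
    | some (.sum args), _ => .sum (args.map fun a => (a.1, sOp a.2))
    | some (.prod _), some _ => .sum [(1, .reg (.ps l (Fintype.card σ)))]
    | some (.prod args), none => .prod (args.map sOp)
    | none, _ => .sum []
  | .pm l t =>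
    match prodSrc P l with
    | some (u, _) =>
      if h : t < Fintype.card σ then .prod [sOp u, .var (enum σ ⟨t, h⟩)] else .sum []
    | none => .sum []
  | .ps _ 0 => .sum []
  | .ps l (t + 1) =>
    match prodSrc P l with
    | some (_, i) =>
      if h : t < Fintype.card σ then
        .sum [(1, .reg (.ps l t)), (A (enum σ ⟨t, h⟩) i, .reg (.pm l t))]
      else .sum [(1, .reg (.ps l t))]
    | none => .sum [(1, .reg (.ps l t))]

/-- The intended values. [cite: BurgisserEtAl2011, §9.3 (closure under the linear action)] -/
noncomputable def val : LReg σ → MvPolynomial σ k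
  | .lf i t => lformP A i t
  | .node l => linSubst σ k A (P.gateVal l)
  | .pm l t => if h : t < Fintype.card σ then bval P A l * X (enum σ ⟨t, h⟩) else 0
  | .ps l t =>
    match prodSrc P l with
    | some (_, i) => ∑ j ∈ Finset.univ.filter (fun j => idx j < t), A j i • (bval P A l * X j)
    | none => 0

/-- The ranks: linear forms first, then gate `l` in the slots `[R₀ + lK, R₀ + (l+1)K)`.
[folklore] -/
def rank : LReg σ → ℕ
  | .lf _ t => t
  | .pm l t => Fintype.card σ + 2 + l * (2 * Fintype.card σ + 3) + t
  | .ps l t => Fintype.card σ + 2 + l * (2 * Fintype.card σ + 3) + Fintype.card σ + t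
  | .node l => Fintype.card σ + 2 + l * (2 * Fintype.card σ + 3) + 2 * Fintype.card σ + 2

/-- The register list. [folklore] -/
noncomputable def regs (m : ℕ) : List (LReg σ) :=
  ((Finset.univ : Finset σ).toList.flatMap fun i =>
      (List.range (Fintype.card σ + 1)).map fun t => LReg.lf i t) ++
    (List.range m).flatMap fun l =>
      LReg.node l :: ((List.range (Fintype.card σ)).map (fun t => LReg.pm l t) ++
        (List.range (Fintype.card σ + 1)).map fun t => LReg.ps l t)

/-- The register program. [cite: BurgisserEtAl2011, §9.3 (closure under the linear action)] -/
noncomputable def prog : RegProg k σ (LReg σ) where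
  regs := regs P.size
  rank := rank
  gateOf := gateOf P A
  output := sOp P.output

/-! ### Register bookkeeping -/

/-- Length of the register list. [folklore] -/
private theorem length_regs (m : ℕ) :
    (regs (σ := σ) m).length =
      Fintype.card σ * (Fintype.card σ + 1) + m * (2 * Fintype.card σ + 2) := by
  rw [regs, List.length_append, List.length_flatMap, List.length_flatMap]
  simp only [List.length_cons, List.length_append, List.length_map, List.length_range,
    List.map_const', List.sum_replicate, smul_eq_mul, Finset.length_toList, Finset.card_univ]
  ring

/-- Membership of a linear-form register. [folklore] -/
private theorem lf_mem_regs {m : ℕ} {i : σ} {t : ℕ} :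
    LReg.lf i t ∈ regs (σ := σ) m ↔ t ≤ Fintype.card σ := by
  simp [regs, List.mem_flatMap]

/-- Membership of a node register. [folklore] -/
private theorem node_mem_regs {m l : ℕ} : LReg.node (σ := σ) l ∈ regs (σ := σ) m ↔ l < m := by
  simp [regs, List.mem_flatMap]

/-- Membership of a product register. [folklore] -/
private theorem pm_mem_regs {m l t : ℕ} :
    LReg.pm (σ := σ) l t ∈ regs (σ := σ) m ↔ l < m ∧ t < Fintype.card σ := by
  simp only [regs, List.mem_append, List.mem_flatMap, Finset.mem_toList, Finset.mem_univ,
    List.mem_map, List.mem_range, reduceCtorEq, and_false, exists_false, false_or,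
    List.mem_cons, List.mem_append, LReg.pm.injEq, false_or, or_false]
  constructor
  · rintro ⟨l', hl', ⟨t', ht', rfl, rfl⟩⟩
    exact ⟨hl', ht'⟩
  · rintro ⟨hl, ht⟩
    exact ⟨l, hl, t, ht, rfl, rfl⟩

/-- Membership of a partial-sum register. [folklore] -/
private theorem ps_mem_regs {m l t : ℕ} :
    LReg.ps (σ := σ) l t ∈ regs (σ := σ) m ↔ l < m ∧ t ≤ Fintype.card σ := by
  simp only [regs, List.mem_append, List.mem_flatMap, Finset.mem_toList, Finset.mem_univ,
    List.mem_map, List.mem_range, reduceCtorEq, and_false, exists_false, false_or,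
    List.mem_cons, List.mem_append, LReg.ps.injEq, false_or, Nat.lt_succ_iff]
  constructor
  · rintro ⟨l', hl', ⟨t', ht', rfl, rfl⟩⟩
    exact ⟨hl', ht'⟩
  · rintro ⟨hl, ht⟩
    exact ⟨l, hl, t, ht, rfl, rfl⟩

/-! ### Semantics -/

/-- The full partial linear form is the linear substitution of the variable. [cite: MulmuleySohoni2001, §4] -/
theorem lformP_card (i : σ) : lformP A i (Fintype.card σ) = linSubst σ k A (X i) := by
  rw [lformP, linSubst_X, Finset.filter_true_of_mem fun j _ => idx_lt j]

/-- One more term of a partial sum over the enumeration. [folklore] -/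
private theorem sum_filter_idx_succ (f : σ → MvPolynomial σ k) (t : ℕ) (h : t < Fintype.card σ) :
    ∑ j ∈ Finset.univ.filter (fun j => idx j < t + 1), f j =
      ∑ j ∈ Finset.univ.filter (fun j => idx j < t), f j + f (enum σ ⟨t, h⟩) := by
  classical
  have hset : Finset.univ.filter (fun j : σ => idx j < t + 1) =
      insert (enum σ ⟨t, h⟩) (Finset.univ.filter fun j => idx j < t) := by
    ext j
    simp only [Finset.mem_filter, Finset.mem_univ, true_and, Finset.mem_insert]
    constructor
    · intro hj
      rcases Nat.lt_succ_iff_lt_or_eq.1 hj with hj | hj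
      · exact Or.inr hj
      · left
        apply idx_injective
        rw [hj, idx_enum]
    · rintro (rfl | hj)
      · rw [idx_enum]; exact Nat.lt_succ_self t
      · exact Nat.lt_succ_of_lt hj
  rw [hset, Finset.sum_insert (by simp [idx_enum]), add_comm]

/-- No more terms beyond the number of variables. [folklore] -/
private theorem sum_filter_idx_of_le (f : σ → MvPolynomial σ k) {t : ℕ} (h : Fintype.card σ ≤ t) :
    ∑ j ∈ Finset.univ.filter (fun j => idx j < t + 1), f j =
      ∑ j ∈ Finset.univ.filter (fun j => idx j < t), f j := by
  congr 1
  ext j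
  simp only [Finset.mem_filter, Finset.mem_univ, true_and]
  have := idx_lt j
  omega

/-- The value of an operand read in the new program. [cite: BurgisserEtAl2011, §9.3 (closure under the linear action)] -/
theorem eval_sOp (hwf : P.WellFormed) {l : ℕ} {g : Gate k σ} (hg : P.gates[l]? = some g)
    {u : Operand k σ} (hu : u ∈ g.args) :
    (sOp u).eval (val P A) = linSubst σ k A (P.opVal l u) := by
  cases u with
  | gate j =>
    have hj : j < l := hwf.1 l g hg _ hu
    simp [sOp, val, opVal_gate, hj]
  | var i => simp [sOp, val, lformP_card]
  | const c => simp [sOp]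

omit [CommRing k] [Fintype σ] in
/-- What an expanded product gate is. [cite: BurgisserEtAl2011, §9.3 (closure under the linear action)] -/
theorem prodSrc_spec {l : ℕ} {u : Operand k σ} {i : σ} (h : prodSrc P l = some (u, i)) :
    (P.gates[l]? = some (.prod [u, .var i])) ∨ (P.gates[l]? = some (.prod [.var i, u])) := by
  rcases hg : P.gates[l]? with _ | ⟨args | args⟩
  · simp [prodSrc, hg] at h
  · simp [prodSrc, hg] at h
  · rcases args with _ | ⟨a, _ | ⟨b, _ | ⟨c, rest⟩⟩⟩
    · simp [prodSrc, hg] at h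
    · cases a <;> simp [prodSrc, hg] at h
    · cases b with
      | var i' =>
        simp only [prodSrc, hg, Option.some.injEq, Prod.mk.injEq] at h
        obtain ⟨rfl, rfl⟩ := h
        exact Or.inl rfl
      | gate j =>
        cases a with
        | var i' =>
          simp only [prodSrc, hg, Option.some.injEq, Prod.mk.injEq] at h
          obtain ⟨rfl, rfl⟩ := h
          exact Or.inr rfl
        | gate _ => simp [prodSrc, hg] at h
        | const _ => simp [prodSrc, hg] at h
      | const c' =>
        cases a with
        | var i' =>
          simp only [prodSrc, hg, Option.some.injEq, Prod.mk.injEq] at h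
          obtain ⟨rfl, rfl⟩ := h
          exact Or.inr rfl
        | gate _ => simp [prodSrc, hg] at h
        | const _ => simp [prodSrc, hg] at h
    · cases a <;> cases b <;> simp [prodSrc, hg] at h

omit [CommRing k] [Fintype σ] in
variable {P} in
/-- A gate that is not expanded has no variable operand in a binary product.
[cite: BurgisserEtAl2011, §9.3 (closure under the linear action)] -/
theorem prodSrc_none_of_pair {l : ℕ} {a b : Operand k σ} (hg : P.gates[l]? = some (.prod [a, b]))
    (h : prodSrc P l = none) : a.isGateRef = true ∨ ∃ c, a = .const c := by
  cases a with
  | gate j => exact Or.inl rfl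
  | const c => exact Or.inr ⟨c, rfl⟩
  | var i => cases b <;> simp [prodSrc, hg] at h

omit [CommRing k] [Fintype σ] in
variable {P} in
/-- (Mirror.) [cite: BurgisserEtAl2011, §9.3 (closure under the linear action)] -/
theorem prodSrc_none_of_pair' {l : ℕ} {a b : Operand k σ} (hg : P.gates[l]? = some (.prod [a, b]))
    (h : prodSrc P l = none) : b.isGateRef = true ∨ ∃ c, b = .const c := by
  cases b with
  | gate j => exact Or.inl rfl
  | const c => exact Or.inr ⟨c, rfl⟩
  | var i => cases a <;> simp [prodSrc, hg] at h

/-- The value of an expanded product gate: `v_l ↦ bval · ℓ_i`.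
[cite: BurgisserEtAl2011, §9.3 (closure under the linear action)] -/
theorem gateVal_of_prodSrc {l : ℕ} {u : Operand k σ} {i : σ}
    (h : prodSrc P l = some (u, i)) :
    linSubst σ k A (P.gateVal l) = bval P A l * linSubst σ k A (X i) := by
  have hb : bval P A l = linSubst σ k A (P.opVal l u) := by
    simp [bval, h]
  rcases prodSrc_spec P h with hg | hg
  · rw [gateVal_of_prod P hg, hb]
    simp [opVal_var]
  · rw [gateVal_of_prod P hg, hb]
    simp [opVal_var, mul_comm]

/-- **The program is realized by the intended values.** [cite: BurgisserEtAl2011, §9.3 (closure under the linear action)] -/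
theorem realizes (hwf : P.WellFormed) : (prog P A).Realizes (val P A) := by
  intro r
  change (gateOf P A r).eval (val P A) = val P A r
  cases r with
  | lf i t =>
    cases t with
    | zero => simp [gateOf, val, lformP, RGate.eval]
    | succ t =>
      simp only [gateOf, val, lformP]
      split_ifs with h
      · simp only [RGate.eval, List.map_cons, List.map_nil, List.sum_cons, List.sum_nil, add_zero,
          one_smul, ROperand.eval_reg, ROperand.eval_var, val, lformP]
        rw [sum_filter_idx_succ _ t h]
      · simp only [RGate.eval, List.map_cons, List.map_nil, List.sum_cons, List.sum_nil, add_zero,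
          one_smul, ROperand.eval_reg, val, lformP]
        rw [sum_filter_idx_of_le _ (not_lt.1 h)]
  | node l =>
    rcases hg : P.gates[l]? with _ | ⟨args | args⟩
    · simp [gateOf, hg, val, RGate.eval, gateVal_of_le P (List.getElem?_eq_none_iff.1 hg), map_zero]
    · simp only [gateOf, hg, val, RGate.eval, List.map_map, gateVal_of_sum P hg, map_list_sum]
      congr 1
      refine List.map_congr_left fun a ha => ?_
      simp only [Function.comp_apply, map_smul]
      rw [eval_sOp P A hwf hg (by simp only [Gate.args, List.mem_map]; exact ⟨a, ha, rfl⟩)]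
    · rcases hp : prodSrc P l with _ | ⟨u, i⟩
      · simp only [gateOf, hg, hp, val, RGate.eval, List.map_map, gateVal_of_prod P hg,
          map_list_prod]
        congr 1
        refine List.map_congr_left fun u hu => ?_
        simp only [Function.comp_apply]
        rw [eval_sOp P A hwf hg (by simpa [Gate.args] using hu)]
      · simp only [gateOf, hg, hp, val, RGate.eval, List.map_cons, List.map_nil, List.sum_cons,
          List.sum_nil, add_zero, one_smul, ROperand.eval_reg]
        rw [gateVal_of_prodSrc P A hp, ← lformP_card, lformP, Finset.mul_sum]
        refine Finset.sum_congr rfl fun j _ => ?_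
        rw [mul_smul_comm]
  | pm l t =>
    rcases hp : prodSrc P l with _ | ⟨u, i⟩
    · simp [gateOf, hp, val, RGate.eval]
      intro h
      simp [bval, hp]
    · simp only [gateOf, hp, val]
      split_ifs with h
      · simp only [RGate.eval, List.map_cons, List.map_nil, List.prod_cons, List.prod_nil, mul_one,
          ROperand.eval_var]
        have hb : bval P A l = linSubst σ k A (P.opVal l u) := by simp [bval, hp]
        rcases prodSrc_spec P hp with hg | hg
        · rw [eval_sOp P A hwf hg (by simp [Gate.args]), hb]
        · rw [eval_sOp P A hwf hg (by simp [Gate.args]), hb]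
      · simp [RGate.eval]
  | ps l t =>
    cases t with
    | zero =>
      rcases hp : prodSrc P l with _ | ⟨u, i⟩
      · simp [gateOf, hp, val, RGate.eval]
      · simp [gateOf, hp, val, RGate.eval]
    | succ t =>
      rcases hp : prodSrc P l with _ | ⟨u, i⟩
      · simp [gateOf, hp, val, RGate.eval]
      · simp only [gateOf, hp, val]
        split_ifs with h
        · simp only [RGate.eval, List.map_cons, List.map_nil, List.sum_cons, List.sum_nil, add_zero,
            one_smul, ROperand.eval_reg, val, hp, dif_pos h]
          rw [sum_filter_idx_succ _ t h]
        · simp only [RGate.eval, List.map_cons, List.map_nil, List.sum_cons, List.sum_nil, add_zero,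
            one_smul, ROperand.eval_reg, val, hp]
          rw [sum_filter_idx_of_le _ (not_lt.1 h)]

/-! ### Fan-in, skewness, ranks -/

/-- Every register gate has fan-in at most two (given that `P` has). [cite: Burgisser2000, Def. 2.1] -/
theorem fanIn_gateOf_le (h2 : P.IsFanInTwo) (r : LReg σ) : (gateOf P A r).fanIn ≤ 2 := by
  cases r with
  | lf i t =>
    cases t with
    | zero => simp [gateOf, RGate.fanIn]
    | succ t =>
      simp only [gateOf]
      split_ifs <;> simp [RGate.fanIn]
  | node l =>
    rcases hg : P.gates[l]? with _ | ⟨args | args⟩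
    · simp [gateOf, hg, RGate.fanIn]
    · have := h2 _ (List.mem_of_getElem? hg)
      simp only [Gate.fanIn, Gate.args, List.length_map] at this
      simpa [gateOf, hg, RGate.fanIn] using this
    · rcases hp : prodSrc P l with _ | ⟨u, i⟩
      · have := h2 _ (List.mem_of_getElem? hg)
        simp only [Gate.fanIn, Gate.args] at this
        simpa [gateOf, hg, hp, RGate.fanIn] using this
      · simp [gateOf, hg, hp, RGate.fanIn]
  | pm l t =>
    rcases hp : prodSrc P l with _ | ⟨u, i⟩
    · simp [gateOf, hp, RGate.fanIn]
    · simp only [gateOf, hp]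
      split_ifs <;> simp [RGate.fanIn]
  | ps l t =>
    cases t with
    | zero => simp [gateOf, RGate.fanIn]
    | succ t =>
      rcases hp : prodSrc P l with _ | ⟨u, i⟩
      · simp [gateOf, hp, RGate.fanIn]
      · simp only [gateOf, hp]
        split_ifs <;> simp [RGate.fanIn]

/-- Every register gate is skew (given that `P` is skew). [cite: BurgisserEtAl2011, §9.4 (skew circuits)] -/
theorem isSkew_gateOf (h2 : P.IsFanInTwo) (hsk : P.IsSkew) (r : LReg σ) : (gateOf P A r).IsSkew := by
  cases r with
  | lf i t =>
    cases t with
    | zero => trivial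
    | succ t =>
      simp only [gateOf]
      split_ifs <;> trivial
  | node l =>
    rcases hg : P.gates[l]? with _ | ⟨args | args⟩
    · simp [gateOf, hg, RGate.IsSkew]
    · simp [gateOf, hg, RGate.IsSkew]
    · rcases hp : prodSrc P l with _ | ⟨u, i⟩
      · -- a product gate without variable operands: register references = gate references
        have hs := hsk _ (List.mem_of_getElem? hg)
        have hf := h2 _ (List.mem_of_getElem? hg)
        simp only [Gate.IsSkew] at hs
        simp only [Gate.fanIn, Gate.args] at hf
        rcases args with _ | ⟨a, _ | ⟨b, _ | ⟨c, rest⟩⟩⟩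
        · simp [gateOf, hg, hp, RGate.IsSkew]
        · cases a <;> simp [gateOf, hg, hp, RGate.IsSkew, sOp, ROperand.isRegRef]
        · simp only [gateOf, hg, hp, RGate.IsSkew, List.map_cons, List.map_nil]
          cases a <;> cases b <;>
            simp_all [prodSrc, sOp, ROperand.isRegRef, Operand.isGateRef]
        · simp at hf
      · simp [gateOf, hg, hp, RGate.IsSkew]
  | pm l t =>
    rcases hp : prodSrc P l with _ | ⟨u, i⟩
    · simp [gateOf, hp, RGate.IsSkew]
    · simp only [gateOf, hp]
      split_ifs
      · cases u <;> simp [RGate.IsSkew, sOp, ROperand.isRegRef]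
      · trivial
  | ps l t =>
    cases t with
    | zero => trivial
    | succ t =>
      rcases hp : prodSrc P l with _ | ⟨u, i⟩
      · simp [gateOf, hp, RGate.IsSkew]
      · simp only [gateOf, hp]
        split_ifs <;> trivial

omit [CommRing k] in
/-- The registers read through `sOp` by gate `l` are registers of the program, of rank below the
slot of `l`. [folklore] -/
private theorem sOp_reads (hwf : P.WellFormed) {l : ℕ} {g : Gate k σ} (hg : P.gates[l]? = some g)
    {u : Operand k σ} (hu : u ∈ g.args) :
    ∀ r' ∈ (sOp u : ROperand k σ (LReg σ)).reads,
      r' ∈ regs (σ := σ) P.size ∧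
        rank r' < Fintype.card σ + 2 + l * (2 * Fintype.card σ + 3) := by
  have hl : l < P.size := (List.getElem?_eq_some_iff.1 hg).1
  intro r' hr'
  cases u with
  | const c => simp [sOp, ROperand.reads] at hr'
  | var i =>
    simp only [sOp, ROperand.reads_reg, List.mem_singleton] at hr'
    subst hr'
    exact ⟨lf_mem_regs.2 le_rfl, by simp only [rank]; omega⟩
  | gate j =>
    simp only [sOp, ROperand.reads_reg, List.mem_singleton] at hr'
    subst hr'
    have hj : j < l := hwf.1 l g hg _ hu
    refine ⟨node_mem_regs.2 (hj.trans hl), ?_⟩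
    simp only [rank]
    have : (j + 1) * (2 * Fintype.card σ + 3) ≤ l * (2 * Fintype.card σ + 3) :=
      Nat.mul_le_mul_right _ hj
    nlinarith

omit [CommRing k] in
/-- The reads of a list of `sOp` operands. [folklore] -/
private theorem reads_map_sOp_sum (args : List (k × Operand k σ)) {r' : LReg σ}
    (h : r' ∈ (RGate.sum (args.map fun a => (a.1, sOp a.2)) : RGate k σ (LReg σ)).reads) :
    ∃ a ∈ args, r' ∈ (sOp a.2 : ROperand k σ (LReg σ)).reads := by
  simp only [RGate.reads, List.flatMap_map, List.mem_flatMap] at h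
  obtain ⟨a, ha, hr⟩ := h
  exact ⟨a, ha, hr⟩

omit [CommRing k] in
/-- The reads of a list of `sOp` operands (products). [folklore] -/
private theorem reads_map_sOp_prod (args : List (Operand k σ)) {r' : LReg σ}
    (h : r' ∈ (RGate.prod (args.map sOp) : RGate k σ (LReg σ)).reads) :
    ∃ u ∈ args, r' ∈ (sOp u : ROperand k σ (LReg σ)).reads := by
  simp only [RGate.reads, List.flatMap_map, List.mem_flatMap] at h
  obtain ⟨a, ha, hr⟩ := h
  exact ⟨a, ha, hr⟩

/-- **The program is well ranked** (well-formed `P`). [cite: BurgisserEtAl2011, §9.3 (closure under the linear action)] -/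
theorem wellRanked (hwf : P.WellFormed) : (prog P A).WellRanked := by
  intro r hr r' hr'
  change r ∈ regs P.size at hr
  change r' ∈ (gateOf P A r).reads at hr'
  change r' ∈ regs P.size ∧ rank r' < rank r
  cases r with
  | lf i t =>
    cases t with
    | zero => simp [gateOf, RGate.reads] at hr'
    | succ t =>
      have ht : t + 1 ≤ Fintype.card σ := lf_mem_regs.1 hr
      simp only [gateOf, dif_pos (show t < Fintype.card σ by omega), RGate.reads, List.flatMap_cons,
        List.flatMap_nil, ROperand.reads_reg, ROperand.reads_var, List.append_nil,
        List.mem_singleton] at hr'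
      subst hr'
      exact ⟨lf_mem_regs.2 (by omega), by simp [rank]⟩
  | node l =>
    have hl : l < P.size := node_mem_regs.1 hr
    obtain ⟨g, hg⟩ : ∃ g, P.gates[l]? = some g := ⟨P.gates[l], List.getElem?_eq_getElem hl⟩
    rcases g with args | args
    · simp only [gateOf, hg] at hr'
      obtain ⟨a, ha, hr''⟩ := reads_map_sOp_sum args hr'
      obtain ⟨hm, hlt⟩ :=
        sOp_reads P hwf hg (by simp only [Gate.args, List.mem_map]; exact ⟨a, ha, rfl⟩) r' hr''
      refine ⟨hm, ?_⟩
      change rank r' < Fintype.card σ + 2 + l * (2 * Fintype.card σ + 3) + 2 * Fintype.card σ + 2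
      omega
    · rcases hp : prodSrc P l with _ | ⟨u, i⟩
      · simp only [gateOf, hg, hp] at hr'
        obtain ⟨u, hu, hr''⟩ := reads_map_sOp_prod args hr'
        obtain ⟨hm, hlt⟩ := sOp_reads P hwf hg (by simpa [Gate.args] using hu) r' hr''
        refine ⟨hm, ?_⟩
        change rank r' < Fintype.card σ + 2 + l * (2 * Fintype.card σ + 3) + 2 * Fintype.card σ + 2
        omega
      · simp only [gateOf, hg, hp, RGate.reads, List.flatMap_cons, List.flatMap_nil,
          ROperand.reads_reg, List.append_nil, List.mem_singleton] at hr'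
        subst hr'
        exact ⟨ps_mem_regs.2 ⟨hl, le_rfl⟩, by simp only [rank]; omega⟩
  | pm l t =>
    obtain ⟨hl, ht⟩ := pm_mem_regs.1 hr
    rcases hp : prodSrc P l with _ | ⟨u, i⟩
    · simp [gateOf, hp, RGate.reads] at hr'
    · simp only [gateOf, hp, dif_pos ht, RGate.reads, List.flatMap_cons, List.flatMap_nil,
        ROperand.reads_var, List.append_nil] at hr'
      have hu : ∃ g, P.gates[l]? = some g ∧ u ∈ g.args := by
        rcases prodSrc_spec P hp with hg | hg
        · exact ⟨_, hg, by simp [Gate.args]⟩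
        · exact ⟨_, hg, by simp [Gate.args]⟩
      obtain ⟨g, hg, hug⟩ := hu
      obtain ⟨hm, hlt⟩ := sOp_reads P hwf hg hug r' hr'
      refine ⟨hm, ?_⟩
      change rank r' < Fintype.card σ + 2 + l * (2 * Fintype.card σ + 3) + t
      omega
  | ps l t =>
    cases t with
    | zero => simp [gateOf, RGate.reads] at hr'
    | succ t =>
      obtain ⟨hl, ht⟩ := ps_mem_regs.1 hr
      rcases hp : prodSrc P l with _ | ⟨u, i⟩
      · simp only [gateOf, hp, RGate.reads, List.flatMap_cons, List.flatMap_nil, ROperand.reads_reg,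
          List.append_nil, List.mem_singleton] at hr'
        subst hr'
        exact ⟨ps_mem_regs.2 ⟨hl, by omega⟩, by simp [rank]⟩
      · simp only [gateOf, hp, dif_pos (show t < Fintype.card σ by omega), RGate.reads,
          List.flatMap_cons, List.flatMap_nil, ROperand.reads_reg, List.append_nil, List.mem_append,
          List.mem_singleton] at hr'
        rcases hr' with rfl | rfl
        · exact ⟨ps_mem_regs.2 ⟨hl, by omega⟩, by simp [rank]⟩
        · exact ⟨pm_mem_regs.2 ⟨hl, by omega⟩, by simp [rank]; omega⟩

/-- **Skew circuits are stable under linear substitution** (the closure of `VP_s = VP_ws` under the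
linear action used in BLMW 2011 §9.3): from a well-formed fan-in-two skew circuit `P` and a square
matrix `A`, a well-formed fan-in-two skew circuit computing `linSubst σ k A P.eval` with
`|σ|(|σ|+1) + (2|σ|+2)·|P|` gates. [cite: BurgisserEtAl2011, §9.3 (closure under the linear action)] -/
theorem exists_skew_linSubst [DecidableEq σ] (hwf : P.WellFormed) (h2 : P.IsFanInTwo)
    (hsk : P.IsSkew) :
    ∃ Q : ArithCircuit k σ, Q.WellFormed ∧ Q.IsFanInTwo ∧ Q.IsSkew ∧
      Q.eval = linSubst σ k A P.eval ∧
      Q.size = Fintype.card σ * (Fintype.card σ + 1) + P.size * (2 * Fintype.card σ + 2) := by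
  have hW := wellRanked P A hwf
  have hV := realizes P A hwf
  have hout' : ∀ r' ∈ (prog P A).output.reads, r' ∈ (prog P A).regs := by
    intro r' hr'
    change r' ∈ (sOp P.output).reads at hr'
    change r' ∈ regs P.size
    have key : ∀ u : Operand k σ, P.output = u → r' ∈ (sOp u : ROperand k σ (LReg σ)).reads →
        r' ∈ regs (σ := σ) P.size := by
      intro u hu h
      cases u with
      | const c => simp [sOp, ROperand.reads] at h
      | var i =>
        simp only [sOp, ROperand.reads_reg, List.mem_singleton] at h
        subst h
        exact lf_mem_regs.2 le_rfl
      | gate j =>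
        simp only [sOp, ROperand.reads_reg, List.mem_singleton] at h
        subst h
        have hj := hwf.2
        rw [hu] at hj
        exact node_mem_regs.2 hj
    exact key _ rfl hr'
  refine ⟨(prog P A).compile, (prog P A).wellFormed_compile hW hout',
    (prog P A).isFanInTwo_compile fun r _ => fanIn_gateOf_le P A h2 r,
    (prog P A).isSkew_compile fun r _ => isSkew_gateOf P A h2 hsk r, ?_, ?_⟩
  · rw [(prog P A).eval_compile hW hV hout', eval_eq_opVal_output]
    change (sOp P.output).eval (val P A) = _
    have key : ∀ u : Operand k σ, P.output = u →
        (sOp u).eval (val P A) = linSubst σ k A (P.opVal P.size u) := by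
      intro u hu
      cases u with
      | const c => simp [sOp]
      | var i => simp [sOp, val, lformP_card]
      | gate j =>
        have hj := hwf.2
        rw [hu] at hj
        change j < P.size at hj
        simp [sOp, val, opVal_gate, hj]
    exact key _ rfl
  · rw [(prog P A).size_compile]
    exact length_regs P.size

end LinSubstSkew

section Complexity

variable {k : Type u} [CommRing k] {σ : Type v} [Fintype σ] [DecidableEq σ]

/-- **`L_skew(A·g) ≤ |σ|(|σ|+1) + (2|σ|+2)·L_skew(g)`**: the corrected skew complexity is
polynomially stable under linear substitution of variables (every commutative ring, every square
matrix). [cite: BurgisserEtAl2011, §9.3 (closure under the linear action)] -/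
theorem skewComplexity_linSubst_le (A : Matrix σ σ k) (g : MvPolynomial σ k) :
    skewComplexity (linSubst σ k A g) ≤
      Fintype.card σ * (Fintype.card σ + 1) + (2 * Fintype.card σ + 2) * skewComplexity g := by
  obtain ⟨P, hwf, h2, hsk, hc, hsz⟩ := HI16Skew.skewComplexity_attained g
  obtain ⟨Q, hQwf, hQ2, hQsk, hQev, hQsz⟩ := LinSubstSkew.exists_skew_linSubst P A hwf h2 hsk
  have h := skewComplexity_le_size (f := linSubst σ k A g) Q hQwf hQ2 hQsk
    (by rw [Computes, hQev]; exact congrArg _ hc)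
  rw [hQsz, hsz] at h
  rw [mul_comm (skewComplexity g)] at h
  exact h

/-- **`L_ws(A·g) ≤ |σ|(|σ|+1) + (2|σ|+2)·4·L_ws(g)`**: the corrected weakly-skew complexity is
polynomially stable under linear substitution (through `L_ws ≤ L_skew ≤ 4·L_ws`).
[cite: BurgisserEtAl2011, §9.3 (closure under the linear action)] -/
theorem wsComplexity_linSubst_le (A : Matrix σ σ k) (g : MvPolynomial σ k) :
    wsComplexity (linSubst σ k A g) ≤
      Fintype.card σ * (Fintype.card σ + 1) + (2 * Fintype.card σ + 2) * (4 * wsComplexity g) := by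
  refine (HI16Skew.wsComplexity_le_skewComplexity _).trans ((skewComplexity_linSubst_le A g).trans ?_)
  have := skewComplexity_le_four_mul_wsComplexity g
  gcongr

/-- **Endomorphism orbits stay in the same skew-complexity regime**: every `g ∈ End(k^σ)·f`
(`endOrbit`, all linear substitutions) has `L_skew(g) ≤ |σ|(|σ|+1) + (2|σ|+2)·L_skew(f)`.
[cite: BurgisserEtAl2011, §9.3 (closure under the linear action)] -/
theorem skewComplexity_le_of_mem_endOrbit {f g : MvPolynomial σ k} (h : g ∈ endOrbit σ k f) :
    skewComplexity g ≤
      Fintype.card σ * (Fintype.card σ + 1) + (2 * Fintype.card σ + 2) * skewComplexity f := by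
  obtain ⟨A, rfl⟩ := h
  exact skewComplexity_linSubst_le A f

/-- Every `g ∈ End(k^σ)·f` has `L_ws(g) ≤ |σ|(|σ|+1) + (2|σ|+2)·4·L_ws(f)`.
[cite: BurgisserEtAl2011, §9.3 (closure under the linear action)] -/
theorem wsComplexity_le_of_mem_endOrbit {f g : MvPolynomial σ k} (h : g ∈ endOrbit σ k f) :
    wsComplexity g ≤
      Fintype.card σ * (Fintype.card σ + 1) + (2 * Fintype.card σ + 2) * (4 * wsComplexity f) := by
  obtain ⟨A, rfl⟩ := h
  exact wsComplexity_linSubst_le A f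

/-- Every `g ∈ GL(k^σ)·f` has `L_ws(g) ≤ |σ|(|σ|+1) + (2|σ|+2)·4·L_ws(f)`.
[cite: BurgisserEtAl2011, §9.3 (closure under the linear action)] -/
theorem wsComplexity_le_of_mem_glOrbit {f g : MvPolynomial σ k} (h : g ∈ glOrbit σ k f) :
    wsComplexity g ≤
      Fintype.card σ * (Fintype.card σ + 1) + (2 * Fintype.card σ + 2) * (4 * wsComplexity f) :=
  wsComplexity_le_of_mem_endOrbit (glOrbit_subset_endOrbit f h)

/-- **`VP_ws` is closed under endomorphism orbits** (p-bounded numbers of variables): if `(f_n) ∈ VP_ws`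
and `g_n ∈ End·f_n` for all `n`, then `(g_n) ∈ VP_ws` — the class-level form of BLMW 2011 §9.3's
use of the linear action. [cite: BurgisserEtAl2011, §9.3 (closure under the linear action)] -/
theorem IsVPwsFamily.of_mem_endOrbit {ς : ℕ → Type v} [∀ n, Fintype (ς n)] [∀ n, DecidableEq (ς n)]
    {f g : ∀ n, MvPolynomial (ς n) k} (hf : IsVPwsFamily f)
    (hς : IsPBounded fun n => Fintype.card (ς n)) (hg : ∀ n, g n ∈ endOrbit (ς n) k (f n)) :
    IsVPwsFamily g := by
  have hb : IsPBounded fun n => Fintype.card (ς n) * (Fintype.card (ς n) + 1) +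
      (2 * Fintype.card (ς n) + 2) * (4 * wsComplexity (f n)) :=
    IsPBounded.add_holds (IsPBounded.mul_holds hς (IsPBounded.add_holds hς (IsPBounded.const 1)))
      (IsPBounded.mul_holds
        (IsPBounded.add_holds (IsPBounded.mul_holds (IsPBounded.const 2) hς) (IsPBounded.const 2))
        (IsPBounded.mul_holds (IsPBounded.const 4) hf))
  exact hb.mono fun n => wsComplexity_le_of_mem_endOrbit (hg n)

end Complexity


end ArithCircuit

end Literature.Computability.AlgebraicComplexity
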